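import Summits.QuantumFields.YangMills.Theorems.BalabanUVNodesK0RecordFormatNamesLemmas6
import Literature.MathematicalPhysics.QuantumFieldTheory.Balaban1983to89.B13NodeTorusFamily

/-!
# K0⁷ record FORMAT⁺ names — lemma file 7 (port-lead T-4a, J-rows part (ii)): the STEP CARRIER's FLOW ROW under the decay-only receipts —
# the HALF-OPEN β-clause of a tower carrying `betaFlowOf F fam ρ bV w` (generic) ∕ `recordBetaFlow[Ax] F a₀ ε₂₉ w` (record), and the SAME-RUN form

DEFINER seat `ym-nodeO-def-1` (gen 34); port-lead LEDGER T-4a «generic step-carrier rows … `sfTowerOfRecord` with `flow := betaFlowOf …`» (the record step carrier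
`Node00.RateRecordW1Maps.sfTowerOfRecord Sg Rz M S fl logZ` has `.flow = fl` by `rfl`; CRIT-1 nodeO STATUS l.3826: hand it `betaFlowOf fam`, never `genFlow`).
After CRIT-1's Q-8 ruling (decay-only currency at the record) the flow row a (5.10)-receipt supports is the β-BOUND clause of [I] Thm 3 p.264 on the
HALF-OPEN coupling interval `]0, γ]` — the box `FlowStep.Box γ k` is `]0, γ]^{k+1}`, and at coupling `0` the limit kernel is the merged term's junk value —
NOT `Step.SFHyp.betaBound`'s closed `[0, γ]` and NOT `betaSmooth` (print's fixed-scheme C^∞ road = the (1.18)-derivative layer `B12BetaSmooth.EDerivBound118`,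
not asserted here).  Kernel-checked bookkeeping; `--kind proof --supports stmt-QuantumFields-20541 --as helper`; count-neutral.

* §1 GENERIC: `PlimDecayOnBoxOf F fam ρ bV γ C δ₁`, `w ∈ ]0, γ]^ℕ` ⟹ `|(betaFlowOf F fam ρ bV w).β (j+1) t| ≤ β′₅.₁₀ = betaPrime510 4 C δ₁` for every `j` and every
  `t ∈ ]0, γ]` (the updated prefix `(w_0, …, w_{j−1}, t)` is a box point: `B13NodeTorusFamily.update_prefixOf_mem_box`); hence for ANY tower `T` with
  `T.flow = betaFlowOf F fam ρ bV w` the same (the step carrier's flow row); SAME-RUN form: `PlimDecayOnRunsOf F fam ρ bV β γ₀ C δ₁` ⟹ along every in-interval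
  solution `gs`, `|(betaFlowOf F fam ρ bV gs).β (k+1) (gs k)| ≤ β′₅.₁₀` for `k ≤ n` (the flow evaluated AT THE RUN's OWN coupling — `Function.update_eq_self`).
* §2 RECORD: the same for `recordBetaFlow F a₀ ε₂₉ w` ∕ `recordBetaFlowAx F a₀ ε₂₉ w` from `RecordPlimDecayOnRuns[Ax]` (runs driven by the record's own β), via
  lemma file 4's `recordBetaFlow_beta_eq_betaFlowOf` ∕ `recordBetaFlowAx_beta_succ`.

HONEST FRAMING.  Helper lemmas (count-neutral); no port text is closed here; slot 8∕9 items not yet born; stub 2′ OPEN; K0⁷ NOT closed (as vetted choice-centred);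
NODE O not inhabited; the Π-holomorphic currency is print's unexecuted alternative (p.266) — record-facing texts read real-coupling decay only; finite 𝕋⁴ at fixed ε —
not continuum ∕ OS ∕ Clay; the Yang–Mills mass gap is NOT proved by any of this.
-/

noncomputable section

open scoped BigOperators Matrix.Norms.L2Operator Topology
open Set Filter

namespace Summit.QuantumFields.YangMills.Theorems.K0RecordFormatNames

open Literature.MathematicalPhysics.QuantumFieldTheory.Balaban1983to89
open Literature.MathematicalPhysics.QuantumFieldTheory.Balaban1983to89.Node00
open Literature.MathematicalPhysics.QuantumFieldTheory.Balaban1983to89.T4Continuum (T4Family)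
open Literature.MathematicalPhysics.QuantumFieldTheory.Balaban1983to89.FlowStep
open Literature.MathematicalPhysics.QuantumFieldTheory.Balaban1983to89.Step (SFTower)
open Literature.MathematicalPhysics.QuantumFieldTheory.Balaban1983to89.T4OutputRate (Window)
open Literature.MathematicalPhysics.QuantumFieldTheory.Balaban1983to89.B13NodeTorusFamily (update_prefixOf_mem_box)

variable (F : T4Family)

/-! ## §1  GENERIC: the half-open β-clause of the (5.42) flow of a term family under the decay-only receipts -/

section Generic

variable {𝔄 : Type*} [NormedRing 𝔄] [NormedAlgebra ℝ 𝔄]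
variable {V : Type*} [NormedAddCommGroup V] [NormedSpace ℝ V] {ι : Type*} [Fintype ι]
variable (fam : TermFamily1 F 𝔄) (ρ : V →L[ℝ] 𝔄) (bV : Module.Basis ι ℝ V)

/-- **THE FLOW ROW, BOX FORM**: uniform (5.10)-decay of the limit kernels on the box `]0, γ]` bounds the (5.42) flow's `β_{j+1}(t)` by `β′₅.₁₀` for every earlier
history `w ∈ ]0, γ]^ℕ`, every step `j`, and every LAST coupling `t ∈ ]0, γ]` (half-open: `t = 0` is off the box). [cite: Balaban1987RG1, p.264 (Thm 3 β-clause «uniformly bounded»), (5.42) p.297, (5.10) p.293, (1.22) p.264] -/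
theorem abs_betaFlowOf_beta_le_of_plimDecayOnBoxOf {γ C δ₁ : ℝ} (h : PlimDecayOnBoxOf F fam ρ bV γ C δ₁) {w : ℕ → ℝ} (hw : w ∈ Window γ)
    (j : ℕ) {t : ℝ} (ht : t ∈ Set.Ioc (0 : ℝ) γ) :
    |(betaFlowOf F fam ρ bV w).β (j + 1) t| ≤ B12Sec2to5.betaPrime510 4 C δ₁ := by
  rw [betaFlowOf_beta_succ, pkOf_apply]
  exact (B12Sec2to5.secondMoment_abs_le_of_decay510 h.1
    (h.2 j _ (update_prefixOf_mem_box (fun i _ => hw i) ⟨ht.1, ht.2⟩))).2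

/-- **… for ANY TOWER CARRYING THIS FLOW** (`T.flow = betaFlowOf F fam ρ bV w` — the step carrier's flow slot, e.g. `RateRecordW1Maps.sfTowerOfRecord … (betaFlowOf …) …`
whose `.flow` is the handed flow by `rfl`): the Thm-3 β-bound clause on the half-open interval. [cite: Balaban1987RG1, p.264 (Thm 3 β-clause), (5.42) p.297] -/
theorem abs_tower_beta_le_of_plimDecayOnBoxOf {P : Params} {G : Type*} [GaugeGroup G] {Φ 𝒢 : Type*} {T : SFTower P G Φ 𝒢} {w : ℕ → ℝ}
    (hT : T.flow = betaFlowOf F fam ρ bV w) {γ C δ₁ : ℝ} (h : PlimDecayOnBoxOf F fam ρ bV γ C δ₁) (hw : w ∈ Window γ)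
    (j : ℕ) {t : ℝ} (ht : t ∈ Set.Ioc (0 : ℝ) γ) : |T.flow.β (j + 1) t| ≤ B12Sec2to5.betaPrime510 4 C δ₁ := by
  rw [hT]
  exact abs_betaFlowOf_beta_le_of_plimDecayOnBoxOf F fam ρ bV h hw j ht

/-- The (5.42) flow AT THE SEQUENCE's OWN coupling is the merged β at the prefix (`Function.update_eq_self`). [cite: Balaban1987RG1, (5.42) p.297, (1.22) p.264 (bookkeeping)] -/
theorem betaFlowOf_beta_self (w : ℕ → ℝ) (k : ℕ) :
    (betaFlowOf F fam ρ bV w).β (k + 1) (w k) = betaMerged F fam ρ bV k (prefixOf w k) := by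
  rw [betaFlowOf_beta_succ, betaMerged_eq_secondMoment_plimOf, ← pkOf_last]
  rfl

/-- **THE FLOW ROW, SAME-RUN FORM**: decay along runs ⟹ along every in-interval solution `gs` of (0.20) driven by `β` up to `n`, the (5.42) flow of the family
AT THE RUN's OWN couplings obeys `|β_{k+1}(g_k)| ≤ β′₅.₁₀` for `k ≤ n`. [cite: Balaban1987RG1, (0.20) p.256, (5.42) p.297, (5.10) p.293, p.264 (Thm 3 β-clause)] -/
theorem abs_betaFlowOf_beta_self_le_of_plimDecayOnRunsOf {β : HBeta} {γ₀ C δ₁ : ℝ} (h : PlimDecayOnRunsOf F fam ρ bV β γ₀ C δ₁)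
    {n : ℕ} {gs : ℕ → ℝ} (hrg : RGEqH n β gs) (hI : Step.InInterval γ₀ n gs) {k : ℕ} (hk : k ≤ n) :
    |(betaFlowOf F fam ρ bV gs).β (k + 1) (gs k)| ≤ B12Sec2to5.betaPrime510 4 C δ₁ := by
  rw [betaFlowOf_beta_self]
  exact abs_betaMerged_le_of_decay510 F fam ρ bV h.1 (h.2 n gs hrg hI k hk)

end Generic

/-! ## §2  RECORD: the flow rows for `recordBetaFlow` ∕ `recordBetaFlowAx` from the record's run receipts -/

variable (a₀ ε₂₉ : ℝ)

/-- **RECORD FLOW ROW, SAME-RUN FORM (bare)**: `RecordPlimDecayOnRuns F a₀ ε₂₉ γ₀ C δ₁` ⟹ along every in-interval solution of the record's own (0.20),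
`|(recordBetaFlow F a₀ ε₂₉ gs).β (k+1) (gs k)| ≤ β′₅.₁₀` for `k ≤ n` — the β-bound clause of the record step carrier handed `fl := recordBetaFlow F a₀ ε₂₉ gs`, at the
run's own couplings. [cite: Balaban1987RG1, (0.20) p.256, (5.42) p.297, (5.10) p.293, p.264 (Thm 3 β-clause)] -/
theorem abs_recordBetaFlow_beta_self_le {γ₀ C δ₁ : ℝ} (h : RecordPlimDecayOnRuns F a₀ ε₂₉ γ₀ C δ₁)
    {n : ℕ} {gs : ℕ → ℝ} (hrg : RGEqH n (betaOfRecord₁₃ F 2 (thetaFill F a₀ ε₂₉)) gs) (hI : Step.InInterval γ₀ n gs) {k : ℕ} (hk : k ≤ n) :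
    |(recordBetaFlow F a₀ ε₂₉ gs).β (k + 1) (gs k)| ≤ B12Sec2to5.betaPrime510 4 C δ₁ := by
  letI θ := thetaFill F a₀ ε₂₉
  letI := θ.instVβ₁; letI := θ.instVβ₂; letI := θ.instιβ
  rw [recordBetaFlow_beta_eq_betaFlowOf]
  exact abs_betaFlowOf_beta_self_le_of_plimDecayOnRunsOf F (recordTerms F a₀ ε₂₉) θ.ρ8 θ.bV
    ((recordPlimDecayOnRuns_iff F a₀ ε₂₉ γ₀ C δ₁).1 h) hrg hI hk

/-- **… Ax twin** (`recordBetaFlowAx`, runs driven by `betaOfRecord₁₃Ax (thetaFill …)`). [cite: Balaban1987RG1, (0.20) p.256, (5.42) p.297, (5.10) p.293] -/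
theorem abs_recordBetaFlowAx_beta_self_le {γ₀ C δ₁ : ℝ} (h : RecordPlimDecayOnRunsAx F a₀ ε₂₉ γ₀ C δ₁)
    {n : ℕ} {gs : ℕ → ℝ} (hrg : RGEqH n (betaOfRecord₁₃Ax F 2 (thetaFill F a₀ ε₂₉)) gs) (hI : Step.InInterval γ₀ n gs) {k : ℕ} (hk : k ≤ n) :
    |(recordBetaFlowAx F a₀ ε₂₉ gs).β (k + 1) (gs k)| ≤ B12Sec2to5.betaPrime510 4 C δ₁ :=
  letI θ := thetaFill F a₀ ε₂₉
  letI := θ.instVβ₁; letI := θ.instVβ₂; letI := θ.instιβ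
  abs_betaFlowOf_beta_self_le_of_plimDecayOnRunsOf F (recordTermsAx F a₀ ε₂₉) θ.ρ8 θ.bV
    ((recordPlimDecayOnRunsAx_iff F a₀ ε₂₉ γ₀ C δ₁).1 h) hrg hI hk

/-- **RECORD FLOW ROW ⟺ THE RUN |β| LETTER**: at the run's own couplings the record's (5.42) flow IS the β of record (ON THE BOX), so the flow row and lemma file 5's
`runAbs_of_recordPlimDecayOnRunsAx` say the same thing (`γ₀ ≤ ½`). [cite: Balaban1987RG1, (5.42) p.297, (1.22) p.264 (bookkeeping)] -/
theorem recordBetaFlowAx_beta_self_eq_betaOfRecord₁₃Ax {γ₀ : ℝ} (hγh : γ₀ ≤ 1 / 2) {n : ℕ} {gs : ℕ → ℝ}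
    (hI : Step.InInterval γ₀ n gs) {k : ℕ} (hk : k ≤ n) :
    (recordBetaFlowAx F a₀ ε₂₉ gs).β (k + 1) (gs k) = betaOfRecord₁₃Ax F 2 (thetaFill F a₀ ε₂₉) k (prefixOf gs k) :=
  (betaOfRecord₁₃Ax_thetaFill_eq_recordBetaFlowAx F a₀ ε₂₉ gs (box_mono hγh (prefixOf_mem_box_of_inInterval hI hk))).symm

end Summit.QuantumFields.YangMills.Theorems.K0RecordFormatNames

end
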